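import Summits.CriticalPhenomena.CardyFormulaZ2.Theorems.CardyWhiteToColouredSimilarityUpgradeOfRectilinearHeart
import Summits.CriticalPhenomena.CardyFormulaZ2.Theorems.CardyAnchoredRigiditySubseqCardyJointLimitRotation
import Summits.CriticalPhenomena.CardyFormulaZ2.Theses.CardyUniqueLimit
import Summits.CriticalPhenomena.CardyFormulaZ2.Theses.CardyMirrorMonotone

/-!
# `SimilarityUpgrade` in the web of ℤ²-Cardy cruxes: the similarity hypothesis is idle
# (crux stmt-CriticalPhenomena-4597, line `registered`, continuation lead c3)

Route `CardyWhiteToColoured`, sub-problem `CardyFormulaZ2`. The crux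
`Summit.CriticalPhenomena.CardyFormulaZ2.Theses.CardyWhiteToColoured.SimilarityUpgrade` reads: IF the
bond-ℤ² crossing probabilities of every conformal rectangle converge to a `Φ` that is invariant under
all similarities `z ↦ a z + w`, THEN some `f` has `R.HasCrossingLimit (bondDomainCrossingProb R) f`
for every `R`. This file places it among the existing items of the sub-problem, over PROVED tree
theorems — the structure theory of joint sequential limits of the sibling line `SubseqCardy`
(`Cruxes.SubseqCardy.Birth.JointLimit.map_addLeft`, `.map_rotateQuad`, `.tendsto_dilate`:
translation invariance from Schramm–Smirnov's domain perturbation, exact scale covariance of the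
discretisation, and rotations from the vendored DKKMO Cor. 1.3 at `q = 1`,
`Literature.Probability.Percolation.dkkmo_crossing_rotation_invariance`):

* `simInvariant_of_fullLimit` — **modulo DKKMO Cor. 1.3, hypothesis (ii) of the crux is idle**: a
  FULL limit `Φ` of the bond-ℤ² crossing probabilities is automatically invariant under every
  similarity `z ↦ a z + w` (`a ≠ 0`): translations and positive dilations unconditionally, rotations
  by the named fact.
* `similarityUpgrade_iff_limitExists_imp_thesis` — hence, modulo DKKMO, the crux is EQUIVALENT to
  `CardyUniqueLimit.LimitExists → CardyUniqueLimit.CardyUniqueLimitThesis` (items stmt-0747 ⇒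
  stmt-0745: "existence of all crossing limits already forces conformal invariance"); the direction
  `(LimitExists → X_U) → SimilarityUpgrade` is unconditional
  (`similarityUpgrade_of_limitExists_imp_thesis`).
* `similarityUpgrade_of_confInvTransport` — the crux follows from `CardyUniqueLimit.ConfInvTransport`
  (stmt-0794) unconditionally (choice of a witness rectangle per modulus, as in the planned glue
  `LimitTransportGlue`).
* `similarityUpgrade_of_subseqConformalInvariance` — the crux follows from
  `CardyMirrorMonotone.SubseqConformalInvariance` (stmt-8266, verbatim twins stmt-4678 and
  `CardyBlackNoise.SubseqConformalInvariance`; equivalent to `SubseqCardy.stub_limitConformal`)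
  unconditionally: run X_M along the meshes `1/(n+1)`.
* `rectilinearHeart_iff_of_dkkmo` — modulo DKKMO, the registered heart H3 of this line is
  equivalent to the same statement WITHOUT its similarity hypothesis: a proof of H3 cannot draw
  anything from similarity invariance that the full-limit clause does not already supply.

So stmt-4597 is dominated by stmt-0794 and by stmt-8266, and is the `LimitExists`-conditional form
of X_U; its open content (H3 ⟺ crux, `rectilinearHeart_iff_similarityUpgrade`) is "existence of the
full crossing limits ⇒ a rectilinear quad and the box of equal modulus have the same limit".

References: H. Duminil-Copin, K. K. Kozlowski, D. Krachun, I. Manolescu, M. Oulamara, *Rotational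
invariance in critical planar lattice models*, arXiv:2012.11672, Cor. 1.3; O. Schramm, S. Smirnov,
Ann. Probab. 39 (2011), §5, Lemma 5.1; B. Bollobás, O. Riordan, *Percolation* (2006), Ch. 7,
Conjecture 1; O. Schramm, Proc. ICM 2006, Problem 2.11.
-/

noncomputable section

namespace Summit.CriticalPhenomena.CardyFormulaZ2.Theorems.SimilarityUpgradeReduction

open Filter Topology Set
open Literature.Probability.RandomPlanarGeometry
open Literature.Probability.Percolation (bondDomainCrossingProb bondDomainCrossingProb_eq_measureReal
  dkkmo_crossing_rotation_invariance rotateQuad arc_rotateQuad carrier_rotateQuad)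
open Summit.CriticalPhenomena.CardyFormulaZ2.Theses
open Summit.CriticalPhenomena.CardyFormulaZ2.Cruxes.SubseqCardy.Birth (JointLimit.map_addLeft
  JointLimit.map_rotateQuad JointLimit.tendsto_dilate JointLimit.tendsto_div_const)

/-! ### Hypothesis (ii) is idle: full limits are similarity invariant (modulo DKKMO Cor. 1.3) -/

/-- **A full limit of the bond-ℤ² crossing probabilities is invariant under every similarity**
(modulo the vendored DKKMO rotation invariance). If `bondDomainCrossingProb R δ → Φ R` as `δ → 0⁺`
for EVERY conformal rectangle `R`, then `Φ R' = Φ R` whenever the carrier and the arcs `0`, `2` of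
`R'` are the images of those of `R` under `z ↦ a z + w`, `a ≠ 0`. Proof: `Φ` is the joint
sequential limit along `1/(n+1)`; write `a = e^{iα}‖a‖`; the dilation by `‖a‖` intertwines the
meshes `1/(n+1)` and `1/((n+1)‖a‖)`, along both of which `Φ` is the limit (`JointLimit.tendsto_dilate`);
the rotation by `α` is `JointLimit.map_rotateQuad` (DKKMO Cor. 1.3, named fact); the translation by
`w` is `JointLimit.map_addLeft` (Schramm–Smirnov perturbation, proved); and the crossing probability
of `R'` depends only on its carrier and arcs `0`, `2`. [cite: DKKMO2020Rotational, Cor. 1.3 (q = 1)] -/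
theorem simInvariant_of_fullLimit (hdk : dkkmo_crossing_rotation_invariance)
    (Φ : ConformalRectangle → ℝ)
    (hlim : ∀ R : ConformalRectangle, Tendsto (bondDomainCrossingProb R) (𝓝[>] (0 : ℝ)) (𝓝 (Φ R))) :
    ∀ (R R' : ConformalRectangle) (a w : ℂ), a ≠ 0 →
      R'.carrier = (fun z : ℂ => a * z + w) '' R.carrier →
      R'.arc 0 = (fun z : ℂ => a * z + w) '' R.arc 0 →
      R'.arc 2 = (fun z : ℂ => a * z + w) '' R.arc 2 → Φ R' = Φ R := by
  intro R R' a w ha hcar h0 h2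
  -- `Φ` is the joint sequential limit along the meshes `1/(n+1)` (which tend to `0⁺`)
  have hu : Tendsto (fun n : ℕ => 1 / ((n : ℝ) + 1)) atTop (𝓝[>] (0 : ℝ)) :=
    tendsto_nhdsWithin_iff.2 ⟨tendsto_one_div_add_atTop_nhds_zero_nat,
      Eventually.of_forall fun n => Set.mem_Ioi.2 (by positivity)⟩
  have hg : ∀ S : ConformalRectangle,
      Tendsto (fun n : ℕ => bondDomainCrossingProb S (1 / ((n : ℝ) + 1))) atTop (𝓝 (Φ S)) :=
    fun S => (hlim S).comp hu
  -- polar decomposition `a = e^{iα} ‖a‖`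
  have hc0 : 0 < ‖a‖ := norm_pos_iff.2 ha
  have hc0' : ((‖a‖ : ℝ) : ℂ) ≠ 0 := Complex.ofReal_ne_zero.2 hc0.ne'
  have ha_eq : (Circle.exp (Complex.arg a) : ℂ) * ((‖a‖ : ℝ) : ℂ) = a := by
    rw [Circle.coe_exp, mul_comm]
    exact Complex.norm_mul_exp_arg_mul_I a
  -- the dilation, as a homeomorphism of the plane
  set Tc : ℂ ≃ₜ ℂ := Homeomorph.mulLeft₀ ((‖a‖ : ℝ) : ℂ) hc0' with hTc_def
  have hTc : ∀ z, Tc z = ((‖a‖ : ℝ) : ℂ) * z := fun z => rfl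
  -- the similarity `z ↦ a z + w` is translation ∘ rotation ∘ dilation
  have himage : ∀ X : Set ℂ, (fun z : ℂ => a * z + w) '' X =
      (Homeomorph.addLeft w) '' ((fun z : ℂ => rotation (Circle.exp (Complex.arg a)) z) ''
        (Tc '' X)) := by
    intro X
    rw [Set.image_image, Set.image_image]
    refine Set.image_congr fun z _ => ?_
    simp only [Homeomorph.coe_addLeft, rotation_apply, hTc]
    rw [← mul_assoc, ha_eq, add_comm]
  -- the chain of rectangles `R ↦ ‖a‖ R ↦ e^{iα} ‖a‖ R ↦ w + a R`
  have hcar3 : ((rotateQuad (Complex.arg a) (R.map Tc)).map (Homeomorph.addLeft w)).carrier =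
      (fun z : ℂ => a * z + w) '' R.carrier := by
    rw [himage, MarkedDomain.carrier_map, carrier_rotateQuad, MarkedDomain.carrier_map]
  have harc3 : ∀ i : Fin 4,
      ((rotateQuad (Complex.arg a) (R.map Tc)).map (Homeomorph.addLeft w)).arc i =
        (fun z : ℂ => a * z + w) '' R.arc i := by
    intro i
    rw [himage, MarkedDomain.arc_map, arc_rotateQuad, MarkedDomain.arc_map]
  -- the crossing probabilities of `R'` are those of the end of the chain, mesh by mesh
  have hP : bondDomainCrossingProb R' =
      bondDomainCrossingProb ((rotateQuad (Complex.arg a) (R.map Tc)).map (Homeomorph.addLeft w)) := by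
    funext δ
    rw [bondDomainCrossingProb_eq_measureReal, bondDomainCrossingProb_eq_measureReal, hcar, h0, h2,
      hcar3, harc3 0, harc3 2]
  have e3 : Φ R' = Φ ((rotateQuad (Complex.arg a) (R.map Tc)).map (Homeomorph.addLeft w)) := by
    refine tendsto_nhds_unique (hlim R') ?_
    rw [hP]
    exact hlim _
  -- translation (Schramm–Smirnov perturbation), rotation (DKKMO), dilation (exact covariance)
  have e2 : Φ ((rotateQuad (Complex.arg a) (R.map Tc)).map (Homeomorph.addLeft w)) =
      Φ (rotateQuad (Complex.arg a) (R.map Tc)) :=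
    JointLimit.map_addLeft hu hg (rotateQuad (Complex.arg a) (R.map Tc)) w
  have e1 : Φ (rotateQuad (Complex.arg a) (R.map Tc)) = Φ (R.map Tc) :=
    JointLimit.map_rotateQuad hdk hu hg (Complex.arg a) (R.map Tc)
  have e0 : Φ (R.map Tc) = Φ R :=
    tendsto_nhds_unique (JointLimit.tendsto_dilate hg hc0 Tc hTc R)
      ((hlim R).comp (JointLimit.tendsto_div_const hu hc0))
  rw [e3, e2, e1, e0]

/-! ### The crux is the `LimitExists`-conditional form of X_U -/

/-- **`(LimitExists → X_U) ⇒ SimilarityUpgrade`** (unconditional): a full similarity-invariant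
limit witnesses `CardyUniqueLimit.LimitExists`, and `CardyUniqueLimit.CardyUniqueLimitThesis` IS the
conclusion of the crux. -/
theorem similarityUpgrade_of_limitExists_imp_thesis
    (h : CardyUniqueLimit.LimitExists → CardyUniqueLimit.CardyUniqueLimitThesis) :
    CardyWhiteToColoured.SimilarityUpgrade := by
  rintro ⟨Φ, hlim, -⟩
  exact h fun R => ⟨Φ R, hlim R⟩

/-- **Modulo DKKMO Cor. 1.3, `SimilarityUpgrade ⟺ (LimitExists → CardyUniqueLimitThesis)`**
(items stmt-0747 ⇒ stmt-0745 of route `CardyUniqueLimit`): the similarity clause of the crux is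
supplied by `simInvariant_of_fullLimit`, and a choice of limits turns `LimitExists` into a full
limit functional `Φ`. [cite: DKKMO2020Rotational, Cor. 1.3 (q = 1)] -/
theorem similarityUpgrade_iff_limitExists_imp_thesis (hdk : dkkmo_crossing_rotation_invariance) :
    CardyWhiteToColoured.SimilarityUpgrade ↔
      (CardyUniqueLimit.LimitExists → CardyUniqueLimit.CardyUniqueLimitThesis) := by
  refine ⟨fun hU hL => ?_, similarityUpgrade_of_limitExists_imp_thesis⟩
  choose Φ hΦ using hL
  exact hU ⟨Φ, hΦ, simInvariant_of_fullLimit hdk Φ hΦ⟩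

/-! ### The crux is implied by the existing conformal-invariance items -/

/-- **`ConfInvTransport ⇒ SimilarityUpgrade`** (stmt-0794 ⇒ stmt-4597, unconditional): given a full
limit `Φ`, put `f η := Φ R_η` for a chosen conformal rectangle `R_η` carrying a uniformizing datum
of cross-ratio `η` (junk `0` if there is none); for `R` with datum `(φ, x)` the witness of
`η = crossRatio x` exists (it may be taken to be `R` itself), and `ConfInvTransport` carries the
limit `Φ R_η` of the witness over to `R`. The similarity clause is not used. -/
theorem similarityUpgrade_of_confInvTransport (hT : CardyUniqueLimit.ConfInvTransport) :
    CardyWhiteToColoured.SimilarityUpgrade := by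
  classical
  rintro ⟨Φ, hlim, -⟩
  refine ⟨fun η => if h : ∃ (S : ConformalRectangle)
      (ψ : ConformalEquiv UpperHalfPlane.upperHalfPlaneSet S.carrier) (y : Fin 4 → ℝ),
      S.IsUniformizing ψ y ∧ crossRatio y = η then Φ h.choose else 0, ?_⟩
  intro R φ x hx
  have h : ∃ (S : ConformalRectangle) (ψ : ConformalEquiv UpperHalfPlane.upperHalfPlaneSet S.carrier)
      (y : Fin 4 → ℝ), S.IsUniformizing ψ y ∧ crossRatio y = crossRatio x := ⟨R, φ, x, hx, rfl⟩
  dsimp only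
  rw [dif_pos h]
  obtain ⟨ψ, y, hy, hcr⟩ := h.choose_spec
  exact hT h.choose R ψ y φ x hy hx hcr (Φ h.choose) (hlim h.choose)

/-- **`SubseqConformalInvariance ⇒ SimilarityUpgrade`** (stmt-8266 ⇒ stmt-4597, unconditional): run
X_M along the meshes `1/(n+1)`; along the extracted subsequence the crossing probabilities of `R`
tend both to `g (crossRatio x)` and to the full limit `Φ R`, so `Φ R = g (crossRatio x)` and `g`
is the sought modulus function. The similarity clause is not used. -/
theorem similarityUpgrade_of_subseqConformalInvariance
    (hX : CardyMirrorMonotone.SubseqConformalInvariance) :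
    CardyWhiteToColoured.SimilarityUpgrade := by
  rintro ⟨Φ, hlim, -⟩
  have hu : Tendsto (fun n : ℕ => 1 / ((n : ℝ) + 1)) atTop (𝓝[>] (0 : ℝ)) :=
    tendsto_nhdsWithin_iff.2 ⟨tendsto_one_div_add_atTop_nhds_zero_nat,
      Eventually.of_forall fun n => Set.mem_Ioi.2 (by positivity)⟩
  obtain ⟨ψ, hψ, g, hg⟩ := hX _ hu
  refine ⟨g, fun R φ x hx => ?_⟩
  have h1 := hg R φ x hx
  have h2 : Tendsto (fun n : ℕ => bondDomainCrossingProb R (1 / (((ψ n : ℕ) : ℝ) + 1))) atTop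
      (𝓝 (Φ R)) :=
    (hlim R).comp (hu.comp hψ.tendsto_atTop)
  have h12 : Φ R = g (crossRatio x) := tendsto_nhds_unique h2 h1
  rw [← h12]
  exact hlim R

/-! ### The heart without its similarity hypothesis -/

/-- **Modulo DKKMO Cor. 1.3, the registered heart H3 (`stub_rectilinearHeart`) is equivalent to the
same statement WITHOUT the similarity hypothesis**: under full limits alone, a rectilinear
conformal rectangle and the corner-marked box of equal modulus have the same limit. (Forward: feed
H3 the similarity invariance of `simInvariant_of_fullLimit`; backward: drop the hypothesis.) So a
proof of H3 can draw nothing from clause (ii) that clause (i) does not already give.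
[cite: DKKMO2020Rotational, Cor. 1.3 (q = 1)] -/
theorem rectilinearHeart_iff_of_dkkmo (hdk : dkkmo_crossing_rotation_invariance) :
    (∀ Φ : ConformalRectangle → ℝ,
      (∀ R : ConformalRectangle, Tendsto (bondDomainCrossingProb R) (𝓝[>] (0 : ℝ)) (𝓝 (Φ R))) →
      (∀ (R R' : ConformalRectangle) (a w : ℂ), a ≠ 0 →
        R'.carrier = (fun z : ℂ => a * z + w) '' R.carrier →
        R'.arc 0 = (fun z : ℂ => a * z + w) '' R.arc 0 →
        R'.arc 2 = (fun z : ℂ => a * z + w) '' R.arc 2 → Φ R' = Φ R) →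
      ∀ (R R' : ConformalRectangle),
        (∃ S : Finset (ℂ × ℂ), (∀ p ∈ S, p.1.re = p.2.re ∨ p.1.im = p.2.im) ∧
          frontier R.carrier ⊆ ⋃ p ∈ S, segment ℝ p.1 p.2) →
        (∃ w : ℝ, 0 < w ∧ R'.carrier = (Ioo (0 : ℝ) w ×ℂ Ioo (0 : ℝ) 1) ∧
          R'.arc 0 = {z : ℂ | z.re = 0 ∧ z.im ∈ Icc (0 : ℝ) 1} ∧
          R'.arc 2 = {z : ℂ | z.re = w ∧ z.im ∈ Icc (0 : ℝ) 1} ∧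
          R'.pt 0 = Complex.I ∧ R'.pt 1 = 0 ∧ R'.pt 2 = (w : ℂ) ∧ R'.pt 3 = (w : ℂ) + Complex.I) →
        ∀ (φ : ConformalEquiv UpperHalfPlane.upperHalfPlaneSet R.carrier) (x : Fin 4 → ℝ)
          (φ' : ConformalEquiv UpperHalfPlane.upperHalfPlaneSet R'.carrier) (x' : Fin 4 → ℝ),
          R.IsUniformizing φ x → R'.IsUniformizing φ' x' → crossRatio x = crossRatio x' →
          Φ R = Φ R') ↔
    (∀ Φ : ConformalRectangle → ℝ,
      (∀ R : ConformalRectangle, Tendsto (bondDomainCrossingProb R) (𝓝[>] (0 : ℝ)) (𝓝 (Φ R))) →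
      ∀ (R R' : ConformalRectangle),
        (∃ S : Finset (ℂ × ℂ), (∀ p ∈ S, p.1.re = p.2.re ∨ p.1.im = p.2.im) ∧
          frontier R.carrier ⊆ ⋃ p ∈ S, segment ℝ p.1 p.2) →
        (∃ w : ℝ, 0 < w ∧ R'.carrier = (Ioo (0 : ℝ) w ×ℂ Ioo (0 : ℝ) 1) ∧
          R'.arc 0 = {z : ℂ | z.re = 0 ∧ z.im ∈ Icc (0 : ℝ) 1} ∧
          R'.arc 2 = {z : ℂ | z.re = w ∧ z.im ∈ Icc (0 : ℝ) 1} ∧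
          R'.pt 0 = Complex.I ∧ R'.pt 1 = 0 ∧ R'.pt 2 = (w : ℂ) ∧ R'.pt 3 = (w : ℂ) + Complex.I) →
        ∀ (φ : ConformalEquiv UpperHalfPlane.upperHalfPlaneSet R.carrier) (x : Fin 4 → ℝ)
          (φ' : ConformalEquiv UpperHalfPlane.upperHalfPlaneSet R'.carrier) (x' : Fin 4 → ℝ),
          R.IsUniformizing φ x → R'.IsUniformizing φ' x' → crossRatio x = crossRatio x' →
          Φ R = Φ R') :=
  ⟨fun hH3 Φ hlim => hH3 Φ hlim (simInvariant_of_fullLimit hdk Φ hlim),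
    fun hH3' Φ hlim _ => hH3' Φ hlim⟩

/-! ### Registered form -/

/-- **Registered sub-goal `fullLimit_simInvariant_of_dkkmo` (line `registered`, lead c3)**: modulo the
vendored DKKMO Cor. 1.3 at `q = 1`, every FULL limit of the bond-ℤ² crossing probabilities is
invariant under all similarities `z ↦ a z + w`, `a ≠ 0` — hypothesis (ii) of the crux
`SimilarityUpgrade` is implied by hypothesis (i) (`simInvariant_of_fullLimit`).
[cite: DKKMO2020Rotational, Cor. 1.3 (q = 1)] -/
theorem fullLimit_simInvariant_of_dkkmo : Literature.Probability.Percolation.dkkmo_crossing_rotation_invariance → ∀ Φ : ConformalRectangle → ℝ, (∀ R : ConformalRectangle, Tendsto (bondDomainCrossingProb R) (𝓝[>] (0 : ℝ)) (𝓝 (Φ R))) → ∀ (R R' : ConformalRectangle) (a w : ℂ), a ≠ 0 → R'.carrier = (fun z : ℂ => a * z + w) '' R.carrier → R'.arc 0 = (fun z : ℂ => a * z + w) '' R.arc 0 → R'.arc 2 = (fun z : ℂ => a * z + w) '' R.arc 2 → Φ R' = Φ R :=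
  fun hdk Φ hlim => simInvariant_of_fullLimit hdk Φ hlim

end Summit.CriticalPhenomena.CardyFormulaZ2.Theorems.SimilarityUpgradeReduction

end
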